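import Literature.Dynamics.Hyperbolic.ClosedOrbitDecoding
import Literature.Dynamics.Hyperbolic.HyperbolicSemiflowModelOrbits
import Literature.Dynamics.Hyperbolic.SemiflowPoincareMap

/-!
# Glue for the closing lemma in a `C²` local semiflow model: Poincaré sections on `Λ`, decoding of closed orbits,
# the neutral flow direction, the invertible base

Topic `Literature/Dynamics/Hyperbolic`.  Fully proved theorems (no definitions, no named facts) instantiating two landed generic
tools at the standing hypotheses `IsHyperbolicSemiflowModel U Λ g m` (Lian–Young 2012 §1; file `HyperbolicSemiflowModel.lean`),
for the closing lemma along Pesin sets (`HasAmbientClosing`; registered stub `stub_ambientClosing` of the Navier–Stokes line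
`ergodic-budget-selection-closing`, `Summits/AnomalousDissipation`; Katok 1980 §3, Lian–Young 2012):

* §1 TRANSVERSAL SECTIONS (block D5).  `deriv_orbit_one` — the velocity of the orbit of `x₀ ∈ Λ` at time `1` is the flow direction
  at `g 1 x₀`; `exists_transitTime_poincareMap` — the transit-time / Poincaré-map package of `SemiflowPoincareMap.lean`
  (`exists_transitTime_poincareMap_of_isOpen` with `n = 2`, `W = (0,2) × U`, `t₀ = 1`) at every `x₀ ∈ Λ` for every functional `ℓ`
  with `ℓ (flowDir g (g 1 x₀)) ≠ 0`: `C²` transit time `τ` and Poincaré map `y ↦ g (τ y) y` to the affine section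
  `{z | ℓ (z − g 1 x₀) = 0}`, Lipschitz on a ball, with a uniqueness window and the derivative formulas — so the hypotheses of D5
  are exactly met by the model (`contDiffOn` on the open `(0,2) × U`, completeness of `E`);
* §2 DECODING (block D8).  `exists_forall_closedOrbit` — for every accuracy `η > 0` there are a closeness radius `r > 0` and a drift
  allowance `A₀ > 0` such that: whenever `x₀ ∈ Λ`, `n ≥ 1`, and points `y 0, …, y n` with `y n = y 0`, each `y j` within `r` of
  `g j x₀`, are linked by transit times `g (τ j) (y j) = y (j+1)` (`j < n`) of total drift `Σ_{j<n} |τ j − 1| ≤ A₀`, then `y 0 ∈ U`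
  lies on a CLOSED ORBIT of `g` inside `U` of period `T`, `0 < T`, `|T − n| ≤ η`, with `dist (g k (y 0)) (g k x₀) ≤ η` for all
  integer `k ≤ n` — verbatim the conclusion of `HasAmbientClosing U Λ g m` for the return of `x₀` at time `n`
  (`ClosedOrbitDecoding.exists_closedOrbit_of_transitSchedule` fed with `HyperbolicSemiflowModelOrbits`).

* §3 NEUTRAL DIRECTION (entry point of block D2).  `flowDir_ae_neutral` — `m`-a.e. the hyperbolicity axiom applies to the flow
  direction (`seqSubExpGrowth_flowDir`); `norm_derivCocycle_flowDir_sub_smul`, `eq_one_of_seqExpDecay_flowDir` — the neutral multiple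
  is `a = 1` wherever the speed `‖flowDir g (gₙ x)‖` does not decay (recurrence to `{‖X‖ ≥ c}`): the zero exponent is carried by `ℝ X`.
* §4 `exists_homeomorph_timeOne` — `g₁|_Λ` is a homeomorphism of `Λ` (the invertible base over which the two-sided multiplicative
  ergodic theorem for `derivCocycle` is to be applied, block D1).

So the closing lemma for hyperbolic measures of the model is reduced to PRODUCING the section points `y j` and transit times `τ j`
with the two smallness conditions — the output of the periodic shadowing theorem in Lyapunov charts on the transversals of §1
(`SequenceShadowingPeriodic`, `SequenceShadowingJump`, `SequenceShadowingRescale`) — and nothing about the ambient semiflow remains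
to be checked afterwards.  Not here: Lyapunov charts / Pesin sets themselves (multiplicative ergodic theorem in Hilbert space).

## References

* A. Katok, *Lyapunov exponents, entropy and periodic orbits for diffeomorphisms*, Publ. Math. IHÉS 51 (1980) 137–173, §3. [Katok1980]
* Z. Lian, L.-S. Young, *Lyapunov exponents, periodic orbits, and horseshoes for semiflows on Hilbert spaces*, J. Amer. Math. Soc. 25
  (2012) 637–665. [LianYoung2012]
* S. Yu. Pilyugin, *Shadowing in Dynamical Systems*, LNM 1706 (1999), §1.5. [Pilyugin1999]
-/

noncomputable section

open Set Function Metric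

namespace Literature.Dynamics.Hyperbolic

namespace IsHyperbolicSemiflowModel

variable {E : Type*} [NormedAddCommGroup E] [NormedSpace ℝ E] [MeasurableSpace E]
  {U Λ : Set E} {g : ℝ → E → E} {m : MeasureTheory.Measure E}

/-! ## §1 Transversal sections at points of `Λ` -/

/-- The velocity of the orbit of `x₀ ∈ Λ` at time `1` is the flow direction at `g 1 x₀`:
`deriv (g · x₀) 1 = flowDir g (g 1 x₀)`. [folklore] -/
theorem deriv_orbit_one (h : IsHyperbolicSemiflowModel U Λ g m) {x₀ : E} (hx₀ : x₀ ∈ Λ) :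
    deriv (fun t => g t x₀) 1 = flowDir g (g 1 x₀) := by
  rw [(h.hasDerivAt_orbit (h.subset hx₀) ⟨one_pos, one_lt_two⟩).deriv, h.flowDir_eq hx₀ rfl]

/-- **Transit time and Poincaré map at a point of `Λ` (block D5 instantiated).**  Let `E` be complete, `x₀ ∈ Λ`, and
`ℓ : E →L[ℝ] ℝ` with `ℓ (flowDir g (g 1 x₀)) ≠ 0` (a section through `x₁ = g 1 x₀` transversal to the flow direction; `x₁` ranges
over all of `Λ = g₁ Λ`).  Then the package `exists_transitTime_poincareMap_of_isOpen` holds at `(1, x₀)` with smoothness `2`: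
radii `ε, η > 0`, a constant `K`, a `C²` transit time `τ` with `τ x₀ = 1`, the Poincaré map `y ↦ g (τ y) y` to the section
`{z | ℓ (z − x₁) = 0}`, both `C²` and `K`-Lipschitz on `ball x₀ ε`, the uniqueness window `(1 − η, 1 + η)`, persistence of
transversality and the derivative formulas along `(τ y, y)`. [folklore] -/
theorem exists_transitTime_poincareMap [CompleteSpace E] (h : IsHyperbolicSemiflowModel U Λ g m) {x₀ : E} (hx₀ : x₀ ∈ Λ)
    {ℓ : E →L[ℝ] ℝ} (hℓ : ℓ (flowDir g (g 1 x₀)) ≠ 0) :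
    ∃ ε > 0, ∃ η > 0, ∃ K : NNReal, ∃ τ : E → ℝ,
      τ x₀ = 1 ∧ g (τ x₀) x₀ = g 1 x₀ ∧
      ContDiffOn ℝ 2 τ (ball x₀ ε) ∧ ContDiffOn ℝ 2 (fun y => g (τ y) y) (ball x₀ ε) ∧
      LipschitzOnWith K τ (ball x₀ ε) ∧ LipschitzOnWith K (fun y => g (τ y) y) (ball x₀ ε) ∧
      (∀ y ∈ ball x₀ ε, τ y ∈ Set.Ioo (1 - η) (1 + η) ∧ (τ y, y) ∈ Set.Ioo (0 : ℝ) 2 ×ˢ U ∧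
        ℓ (g (τ y) y - g 1 x₀) = 0) ∧
      (∀ y ∈ ball x₀ ε, ∀ t ∈ Set.Ioo (1 - η) (1 + η), ℓ (g t y - g 1 x₀) = 0 → t = τ y) ∧
      ∀ y ∈ ball x₀ ε,
        ContDiffAt ℝ 2 (fun q : ℝ × E => g q.1 q.2) (τ y, y) ∧
        ℓ (deriv (fun t => g t y) (τ y)) ≠ 0 ∧
        fderiv ℝ τ y = -(ℓ (deriv (fun t => g t y) (τ y)))⁻¹ • ℓ.comp (fderiv ℝ (g (τ y)) y) ∧
        fderiv ℝ (fun z => g (τ z) z) y =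
          fderiv ℝ (g (τ y)) y + (fderiv ℝ τ y).smulRight (deriv (fun t => g t y) (τ y)) := by
  have hℓ' : ℓ (deriv (fun t => g t x₀) 1) ≠ 0 := by rwa [h.deriv_orbit_one hx₀]
  exact exists_transitTime_poincareMap_of_isOpen (n := 2) (by norm_num) (by decide) (isOpen_Ioo.prod h.isOpen)
    ⟨⟨one_pos, one_lt_two⟩, h.subset hx₀⟩ h.contDiffOn hℓ'

/-! ## §2 Decoding closed orbits -/

/-- **Decoding closed orbits in the model.**  For every `η > 0` there are `r > 0` and `A₀ > 0` such that for all `x₀ ∈ Λ`, `n ≥ 1`,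
`y : ℕ → E`, `τ : ℕ → ℝ` with `dist (y j) (g j x₀) < r` (`j ≤ n`), `g (τ j) (y j) = y (j + 1)` (`j < n`), `y n = y 0` and
`Σ_{j<n} |τ j − 1| ≤ A₀`: `y 0 ∈ U` and there is `T > 0`, `|T − n| ≤ η`, with `g [0, T] (y 0) ⊆ U`, `g T (y 0) = y 0` and
`dist (g k (y 0)) (g k x₀) ≤ η` for every integer `k ≤ n`.  (`T = Σ_{j<n} τ j`; `r` comes from uniform continuity of the model near
`[0, 7/4] × Λ` at accuracy `η/2`, `A₀ = min (1/4) (η / (2 (V + 1)))` with `V` the time-Lipschitz constant of orbits in `Λ`.)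
[folklore] -/
theorem exists_forall_closedOrbit (h : IsHyperbolicSemiflowModel U Λ g m) {η : ℝ} (hη : 0 < η) :
    ∃ r > 0, ∃ A₀ > 0, ∀ x₀ ∈ Λ, ∀ n : ℕ, 0 < n → ∀ (y : ℕ → E) (τ : ℕ → ℝ),
      (∀ j ≤ n, dist (y j) (g j x₀) < r) → (∀ j < n, g (τ j) (y j) = y (j + 1)) → y n = y 0 →
      ∑ j ∈ Finset.range n, |τ j - 1| ≤ A₀ →
      y 0 ∈ U ∧ ∃ T : ℝ, 0 < T ∧ |T - n| ≤ η ∧ (∀ t ∈ Icc 0 T, g t (y 0) ∈ U) ∧ g T (y 0) = y 0 ∧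
        ∀ k : ℕ, k ≤ n → dist (g k (y 0)) (g k x₀) ≤ η := by
  obtain ⟨V, hV0, hV⟩ := h.exists_forall_dist_orbit_le
  obtain ⟨r, hr, hnear⟩ := h.exists_forall_dist_apply_lt (S := 7 / 4) (by norm_num) (half_pos hη)
  set A₀ : ℝ := min (1 / 4) (η / (2 * (V + 1))) with hA₀
  have hA₀pos : 0 < A₀ := lt_min (by norm_num) (by positivity)
  have hA₀q : A₀ ≤ 1 / 4 := min_le_left _ _
  have hVA : V * A₀ ≤ η / 2 := by
    have h1 : V * (η / (2 * (V + 1))) = V / (V + 1) * (η / 2) := by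
      field_simp
    have h2 : V / (V + 1) ≤ 1 := (div_le_one (by linarith)).2 (by linarith)
    calc V * A₀ ≤ V * (η / (2 * (V + 1))) := mul_le_mul_of_nonneg_left (min_le_right _ _) hV0
      _ = V / (V + 1) * (η / 2) := h1
      _ ≤ 1 * (η / 2) := mul_le_mul_of_nonneg_right h2 (half_pos hη).le
      _ = η / 2 := one_mul _
  have hA₀η : A₀ ≤ η := by
    have h2 : η / (2 * (V + 1)) ≤ η := by
      rw [div_le_iff₀ (by positivity)]
      nlinarith
    exact (min_le_right _ _).trans h2
  refine ⟨min r η, lt_min hr hη, A₀, hA₀pos, fun x₀ hx₀ n hn y τ hy hstep hper hA => ?_⟩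
  -- the data of `exists_closedOrbit_of_transitSchedule` with `c = 1/2`, `S = 7/4`, `β = η/2`, `ε = η`
  have hyr : ∀ j ≤ n, dist (y j) (g j x₀) < r := fun j hj => (hy j hj).trans_le (min_le_left _ _)
  have hxj : ∀ j : ℕ, g j x₀ ∈ Λ := fun j => h.mapsTo j j.cast_nonneg hx₀
  have hN := fun j (hj : j ≤ n) => hnear (g j x₀) (hxj j) (y j) (hyr j hj)
  have hx0 : g 0 x₀ = x₀ := h.map_zero x₀ (h.subset hx₀)
  have hε0 : dist (y 0) x₀ ≤ η := by
    have h1 := (hy 0 (Nat.zero_le n)).trans_le (min_le_right _ _)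
    rw [Nat.cast_zero, hx0] at h1
    exact h1.le
  obtain ⟨hyU, T, hT, hTn, horb, hfix, hdist⟩ := exists_closedOrbit_of_transitSchedule (c := 1 / 2) (S := 7 / 4) (β := η / 2)
    h.map_zero h.map_add hn hA (hA₀q.trans_lt (by norm_num)) (by norm_num) (by norm_num) (by linarith) hx0
    (fun s t hs ht => h.map_add_of_mem hs ht hx₀) (hV x₀ hx₀) (fun j hj => (hN j hj).1)
    (fun j hj s hs => ((hN j hj).2 s hs).1) hstep hper
    (fun j hj s hs => ((hN j hj).2 s ⟨by linarith [hs.1], hs.2⟩).2.le) (by linarith) hε0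
  exact ⟨hyU, T, hT, hTn.trans hA₀η, horb, hfix, hdist⟩

/-! ## §3 The flow direction is a neutral direction of the cocycle (entry point of block D2) -/

/-- **`m`-a.e. the hyperbolicity axiom applies to the flow direction**: for `m`-a.e. `x` there is `a : ℝ` with
`‖Tⁿₓ (X(x) − a X(x))‖` exponentially decaying (`X = flowDir g`; combine the field `hyperbolic` with `seqSubExpGrowth_flowDir`).
[folklore] -/
theorem flowDir_ae_neutral (h : IsHyperbolicSemiflowModel U Λ g m) :
    ∀ᵐ x ∂m, ∃ a : ℝ, SeqExpDecay fun n => ‖derivCocycle g x n (flowDir g x - a • flowDir g x)‖ := by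
  filter_upwards [h.hyperbolic, h.ae_mem] with x hx hxΛ
  exact hx (flowDir g x) (h.seqSubExpGrowth_flowDir hxΛ)

/-- Along `Λ`, `‖Tⁿₓ (X(x) − a X(x))‖ = |1 − a| ‖X(gₙ x)‖`. [folklore] -/
theorem norm_derivCocycle_flowDir_sub_smul (h : IsHyperbolicSemiflowModel U Λ g m) {x : E} (hx : x ∈ Λ) (a : ℝ) (n : ℕ) :
    ‖derivCocycle g x n (flowDir g x - a • flowDir g x)‖ = |1 - a| * ‖flowDir g (g n x)‖ := by
  have e : flowDir g x - a • flowDir g x = (1 - a) • flowDir g x := by rw [sub_smul, one_smul]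
  rw [e, map_smul, h.derivCocycle_apply_flowDir hx, norm_smul, Real.norm_eq_abs]

/-- **The neutral multiple is `a = 1` wherever the speed does not decay**: if `x ∈ Λ`, `‖Tⁿₓ (X(x) − a X(x))‖` decays exponentially
and the speed `‖X(gₙ x)‖` is `≥ c > 0` for infinitely many `n` (e.g. `x` recurrent to `{‖X‖ ≥ c}`), then `a = 1` — the flow
direction itself is the (only) direction of sub-exponential growth modulo the stable one, i.e. the zero exponent is carried by `ℝ X(x)`.
[folklore] -/
theorem eq_one_of_seqExpDecay_flowDir (h : IsHyperbolicSemiflowModel U Λ g m) {x : E} (hx : x ∈ Λ) {a : ℝ}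
    (hdec : SeqExpDecay fun n => ‖derivCocycle g x n (flowDir g x - a • flowDir g x)‖) {c : ℝ} (hc : 0 < c)
    (hfreq : ∃ᶠ n : ℕ in Filter.atTop, c ≤ ‖flowDir g (g n x)‖) : a = 1 := by
  by_contra hne
  obtain ⟨κ, hκ, C, hC⟩ := hdec
  have h1a : 0 < |1 - a| := abs_pos.2 (sub_ne_zero.2 (Ne.symm hne))
  -- `C e^{-κ n} → 0`, so eventually `C e^{-κ n} < |1 - a| c`
  have hlim : Filter.Tendsto (fun n : ℕ => C * Real.exp (-(κ * n))) Filter.atTop (nhds 0) := by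
    have h1 : Filter.Tendsto (fun n : ℕ => -(κ * (n : ℝ))) Filter.atTop Filter.atBot := by
      have h2 : Filter.Tendsto (fun n : ℕ => κ * (n : ℝ)) Filter.atTop Filter.atTop :=
        Filter.Tendsto.const_mul_atTop hκ tendsto_natCast_atTop_atTop
      exact Filter.tendsto_neg_atTop_atBot.comp h2
    simpa using (Real.tendsto_exp_atBot.comp h1).const_mul C
  have hev : ∀ᶠ n : ℕ in Filter.atTop, C * Real.exp (-(κ * n)) < |1 - a| * c :=
    (Filter.Tendsto.eventually_lt_const (mul_pos h1a hc) hlim)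
  obtain ⟨n, hn1, hn2⟩ := (hfreq.and_eventually hev).exists
  have h3 := hC n
  simp only at h3
  rw [h.norm_derivCocycle_flowDir_sub_smul hx a n] at h3
  have h4 : |1 - a| * c ≤ |1 - a| * ‖flowDir g (g n x)‖ := mul_le_mul_of_nonneg_left hn1 h1a.le
  linarith

/-! ## §4 The time-one map is a homeomorphism of `Λ` (the invertible base of the cocycle, block D1) -/

/-- **`g₁|_Λ` is a homeomorphism of the compact invariant set** (continuous bijection of a compact Hausdorff space): the derivative
cocycle `derivCocycle g x` lives over an INVERTIBLE base `(Λ, g₁)`, as the two-sided multiplicative ergodic theorem requires.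
[folklore] -/
theorem exists_homeomorph_timeOne (h : IsHyperbolicSemiflowModel U Λ g m) : ∃ Φ : Λ ≃ₜ Λ, ∀ p : Λ, ((Φ p : Λ) : E) = g 1 p := by
  have h1 : Continuous (fun x' : E => ((1 : ℝ), x')) := continuous_const.prodMk continuous_id
  have hg1 : ContinuousOn (g 1) Λ :=
    h.continuousOn.comp h1.continuousOn fun x' hx' => ⟨⟨zero_le_one, one_le_two⟩, h.subset hx'⟩
  haveI : CompactSpace Λ := isCompact_iff_compactSpace.1 h.isCompact
  let φ : Λ → Λ := fun p => ⟨g 1 p, h.mapsTo 1 zero_le_one p.2⟩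
  have hφc : Continuous φ := continuous_induced_rng.2 (hg1.comp_continuous continuous_subtype_val fun p => p.2)
  have hφb : Function.Bijective φ := by
    refine ⟨fun p q hpq => Subtype.ext (h.injOn 1 zero_le_one p.2 q.2 (congrArg Subtype.val hpq)), fun q => ?_⟩
    obtain ⟨p, hp, hpq⟩ := h.surjOn 1 zero_le_one q.2
    exact ⟨⟨p, hp⟩, Subtype.ext hpq⟩
  exact ⟨Continuous.homeoOfEquivCompactToT2 (f := Equiv.ofBijective φ hφb) hφc, fun p => rfl⟩

end IsHyperbolicSemiflowModel

end Literature.Dynamics.Hyperbolic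

end
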